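import Literature.Algebra.EuclideanLattices.MRGapCVPBlocksD
import Literature.Algebra.EuclideanLattices.MRGapCVPRunDOrder
import Literature.Algebra.EuclideanLattices.MRGapCVPVerifierBridge
import Literature.Algebra.EuclideanLattices.MRGapCVPScaledNoInstance
import HarnessLib

/-!
# MR07 Thm. 5.23 at model level on the dual-grid data the machine computes: YES instances are never accepted, NO instances are accepted except with small probability — proved

Topic `Algebra/EuclideanLattices` (family `pqc`). The machine of Micciancio–Regev 2007, Thm. 5.23 (after the
short dual set `S ⊂ Λ = dualLat I.basis` has been obtained) runs `k·N_w` runs of `W(B, S)` in sampling order, keeps the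
first success of each of the `N_w` blocks, and accepts ("NO instance") iff every block succeeded and the
all-integer verifier `intAcceptsZ` holds on the witness numerators. With the exact sampler `D_{ℤ,Ns,0}` this is
the INTEGER process

  `Wit = witnessesOf (wAttempt I.basis N S O s β ℓ) N_w k : PMF (Fin N_w → Option ℤⁿ)`,
  `Acc = {o | (∀ i, oᵢ ≠ none) ∧ intAcceptsZ t (num d) (den d) Dg P (i ↦ oᵢ)}`.

This file proves the two correctness statements for `(Wit, Acc)` on a `GapCVP′` instance `((B, t), d)`:

* `mem_dualLat_of_mem_support` — every witness in the support of `Wit` is a vector of `Λ` (`uVec_mem`);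
* **`toOuterMeasure_acc_eq_zero_of_infDist_le`** — YES instances (`dist(t, L(B)) ≤ d`): `Wit(Acc) = 0`, for ANY
  `S` with rows in `Λ`, any oracle and any parameters (`MRGapCVPVerifierBridge.not_intAcceptsZ_of_infDist_le`);
* `witnessesOf_map`, `toWLat`, `map_wAttempt_toWLat_eq` — reading the integer process as the analysed
  `witnessesD` (`List.map_findSome?`; the reading `toWLat` is total and agrees with `toW` on the support);
* **`toReal_toOuterMeasure_not_acc_le`** — NO instances (`γd < λ₁(L(B))`, `γd < dist(kt, L(B))` for odd `k`)
  with `S ⊂ Λ` independent, `‖sⱼ‖ ≤ σ`, `n√m βσ/q < sβ`, Gaussian parameter `s ≥ 2√n Dg/(γd)`, `q ≤ N`, the side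
  condition of Thm. 5.9, oracle success `δ′` above the slack, thresholds with the trace slack
  `n(3N_w(2sβ)²d²/Dg²)^{2^P} ≤ (3N_w/100)^{2^P}`: `Wit(Accᶜ) ≤ errD` (the bound of
  `MRGapCVPBlocksD.toReal_witnessesD_not_acceptsZ_le` with `θ_b = 3/80`, `δ_H = (1 − 2·2⁻ⁿ)/(2π²) − 3/80`);
* `abs_toOuterMeasure_witnessesOf_sub_le` — replacing the sampler by the machine's `D′` moves every probability by
  at most `N_w k m n Δ(D′, D_{ℤ,Ns,0})`.

All proved; no named fact.

## References

* D. Micciancio, O. Regev, *Worst-case to average-case reductions based on Gaussian measures*,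
  SIAM J. Comput. 37 (2007) 267–302; authors' version, Thm. 5.23 and its proof, pp. 28–31.
* O. Goldreich, *Foundations of Cryptography I*, CUP 2001, §3.2 [Goldreich2001].
-/

noncomputable section

open scoped Classical ENNReal Real InnerProductSpace

namespace Literature.Algebra.EuclideanLattices

open Module Submodule Matrix GSInverse Finset Metric Literature.Probability.Distributions PMF MeasureTheory
  Literature.Computability.Cryptography Literature.Computability.Cryptography.SIS MicciancioRegev2007
  MicciancioRegev2007.VerifierZ Literature.NumberTheory.Sieve.Vinogradov

/-! ### Generic: blocks commute with coordinatewise maps; map congruence on the support -/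

namespace DualGrid

/-- **First successes commute with a map of the values**: `witnessesOf (p.map (Option.map f)) =
(witnessesOf p).map (o ↦ (oⱼ.map f)ⱼ)`. [folklore] -/
theorem witnessesOf_map {α β : Type*} (p : PMF (Option α)) (f : α → β) (Nw k : ℕ) :
    witnessesOf (p.map (Option.map f)) Nw k = (witnessesOf p Nw k).map fun o j => (o j).map f := by
  rw [witnessesOf, witnessesOf, indepLaw_map_pi]
  congr 1
  funext i
  rw [← indepLaw_map_pi k (fun _ => p) (fun _ => Option.map f), PMF.map_comp, PMF.map_comp]
  congr 1
  funext v
  simp only [Function.comp_apply]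
  rw [List.map_findSome?]
  have h : (List.ofFn fun j => (v j).map f) = (List.ofFn v).map (Option.map f) := by
    rw [List.map_ofFn]; rfl
  rw [h, List.findSome?_map]
  rfl

/-- Two maps that agree on the support push a `PMF` forward to the same law. [folklore] -/
theorem _root_.PMF.map_congr_support {α β : Type*} (p : PMF α) {f g : α → β} (h : ∀ a ∈ p.support, f a = g a) :
    p.map f = p.map g := by
  ext b
  simp only [PMF.map_apply]
  refine tsum_congr fun a => ?_
  by_cases ha : a ∈ p.support
  · rw [h a ha]
  · rw [(PMF.apply_eq_zero_iff p a).2 ha]; simp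

variable (I : LatticeInstance) (N : ℕ) (S : Fin I.n → Fin I.n → ℤ) [NeZero N] {m : ℕ}

/-! ### The support of the integer process -/

variable {I N S} in
omit [NeZero N] in
/-- **Every output of a run in sampling order is a vector of `Λ`.** [cite: MicciancioRegev2007, Thm. 5.23 (proof, p. 29: "w ∈ L(B)*")] -/
theorem mem_dualLat_of_mem_support_wAttempt (hS : ∀ j, intVecToEuclidean I.n (S j) ∈ dualLat I.basis) {q : ℕ}
    {O : Matrix (Fin I.n) (Fin m) (ZMod q) → PMF (Fin m → ℤ)} {s β : ℝ} {ℓ : ℕ} {u : Fin I.n → ℤ}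
    (hu : some u ∈ (wAttempt I.basis N S O s β ℓ).support) : intVecToEuclidean I.n u ∈ dualLat I.basis := by
  simp only [wAttempt, wAttemptWith, PMF.mem_support_bind_iff, PMF.support_map, Set.mem_image] at hu
  obtain ⟨K, -, κ, -, z, -, hz⟩ := hu
  by_cases hsol : IsSolution' (Amat I.basis N S q K κ) β z
  · rw [if_pos hsol] at hz
    rw [← Option.some_injective _ hz]
    exact uVec_mem hS q K κ z
  · rw [if_neg hsol] at hz
    exact (Option.some_ne_none u hz.symm).elim

variable {I N S} in
omit [NeZero N] in
/-- **Every witness in the support of the blocks is a vector of `Λ`.** [folklore] -/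
theorem mem_dualLat_of_mem_support (hS : ∀ j, intVecToEuclidean I.n (S j) ∈ dualLat I.basis) {q : ℕ}
    {O : Matrix (Fin I.n) (Fin m) (ZMod q) → PMF (Fin m → ℤ)} {s β : ℝ} {ℓ Nw k : ℕ} {o : Fin Nw → Option (Fin I.n → ℤ)}
    (ho : o ∈ (witnessesOf (wAttempt I.basis N S O s β ℓ) Nw k).support) {j : Fin Nw} {u : Fin I.n → ℤ} (hj : o j = some u) :
    intVecToEuclidean I.n u ∈ dualLat I.basis := by
  have h1 := mem_support_of_mem_support_indepLaw ho j
  rw [PMF.support_map, Set.mem_image] at h1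
  obtain ⟨v, hv, hvo⟩ := h1
  rw [hj] at hvo
  obtain ⟨a, ha, hau⟩ := List.exists_of_findSome?_eq_some hvo
  simp only [id] at hau
  obtain ⟨i, rfl⟩ := (List.mem_ofFn' _ _).1 ha
  have hi := mem_support_of_mem_support_indepLaw hv i
  rw [hau] at hi
  exact mem_dualLat_of_mem_support_wAttempt hS hi

/-! ### YES instances -/

omit [NeZero N] in
/-- **On a YES instance the integer process never accepts**: if `dist(t, L(B)) ≤ d` then
`Pr[(∀ i, oᵢ ≠ none) ∧ intAcceptsZ t (num d) (den d) Dg P o] = 0`, for every dual set `S ⊂ Λ`, oracle and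
parameters (`N_w ≥ 1`, `P ≥ 1`). [cite: MicciancioRegev2007, Thm. 5.23 (proof, YES case, p. 29: "V outputs No whenever dist(t, L(B)) ≤ d")] -/
theorem toOuterMeasure_acc_eq_zero_of_infDist_le (hI : I.IsNonsingular) (hS : ∀ j, intVecToEuclidean I.n (S j) ∈ dualLat I.basis)
    {q : ℕ} (O : Matrix (Fin I.n) (Fin m) (ZMod q) → PMF (Fin m → ℤ)) (s β : ℝ) (ℓ : ℕ) {Nw : ℕ} (hNw : 1 ≤ Nw) (k : ℕ)
    {t : Fin I.n → ℤ} {d : ℚ} (hd : 0 < d)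
    (hdist : infDist (intVecToEuclidean I.n t) ((I.lattice : Set (EuclideanSpace ℝ (Fin I.n)))) ≤ d)
    {P : ℕ} (hP : 1 ≤ P) :
    (witnessesOf (wAttempt I.basis N S O s β ℓ) Nw k).toOuterMeasure
        {o | (∀ i, o i ≠ none) ∧ intAcceptsZ t d.num d.den (Dg I.basis).toNat P fun j => (o j).getD 0} = 0 := by
  rw [PMF.toOuterMeasure_apply_eq_zero_iff]
  refine Set.disjoint_left.2 fun o ho ⟨hsome, hacc⟩ => ?_
  have hu : ∀ j, intVecToEuclidean I.n ((o j).getD 0) ∈ dualLat I.basis := fun j => by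
    obtain ⟨u, hu⟩ := Option.ne_none_iff_exists'.1 (hsome j)
    rw [hu, Option.getD_some]
    exact mem_dualLat_of_mem_support hS ho hu
  exact not_intAcceptsZ_of_infDist_le hI hu hd hdist hNw hP hacc

/-! ### Reading the integer process as the analysed witnesses -/

/-- **Reading an integer vector in `(Λ*)*`, totally** (`0` for the vectors outside — never met). [folklore] -/
def toWLat [IsZLattice ℝ (dualLat I.basis)] (v : Fin I.n → ℤ) : WLat I.basis :=
  if h : intVecToEuclidean I.n v ∈ WLat I.basis then ⟨_, h⟩ else 0

variable {I} in
/-- `toWLat` of a vector of `Λ`. [folklore] -/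
theorem toWLat_of_mem [IsZLattice ℝ (dualLat I.basis)] {v : Fin I.n → ℤ} (hv : intVecToEuclidean I.n v ∈ dualLat I.basis) :
    toWLat I v = ⟨intVecToEuclidean I.n v, mem_WLat_of_mem hv⟩ := by
  rw [toWLat, dif_pos (mem_WLat_of_mem hv)]

variable {I} in
/-- `toW v = some (toWLat v)` for a vector of `Λ`. [folklore] -/
theorem toW_eq_some_toWLat [IsZLattice ℝ (dualLat I.basis)] {v : Fin I.n → ℤ} (hv : intVecToEuclidean I.n v ∈ dualLat I.basis) :
    toW I.basis v = some (toWLat I v) := by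
  rw [toW_of_mem hv, toWLat_of_mem hv]

/-- **The run in sampling order read through `toWLat` is `wRunD`** (the two readings agree on the support).
[cite: MicciancioRegev2007, Thm. 5.23 (proof, step (2), p. 29) with Lemma 5.7] -/
theorem map_wAttempt_toWLat_eq [IsZLattice ℝ (dualLat I.basis)] (hI : I.IsNonsingular) (hS : ∀ j, intVecToEuclidean I.n (S j) ∈ dualLat I.basis)
    {q : ℕ} (O : Matrix (Fin I.n) (Fin m) (ZMod q) → PMF (Fin m → ℤ)) {s : ℝ} (hs : 0 < s) (β : ℝ) (ℓ : ℕ) :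
    (wAttempt I.basis N S O s β ℓ).map (Option.map (toWLat I)) = wRunD I.basis N S hI O s β ℓ := by
  rw [← map_wAttempt_eq hI hS O hs β ℓ]
  refine PMF.map_congr_support _ fun o ho => ?_
  cases o with
  | none => rfl
  | some u => rw [Option.map_some, Option.bind_some, toW_eq_some_toWLat (mem_dualLat_of_mem_support_wAttempt hS ho)]

/-- **The integer blocks read through `toWLat` are `witnessesD`.** [folklore] -/
theorem map_witnessesOf_wAttempt_eq [IsZLattice ℝ (dualLat I.basis)] (hI : I.IsNonsingular) (hS : ∀ j, intVecToEuclidean I.n (S j) ∈ dualLat I.basis)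
    {q : ℕ} (O : Matrix (Fin I.n) (Fin m) (ZMod q) → PMF (Fin m → ℤ)) {s : ℝ} (hs : 0 < s) (β : ℝ) (ℓ Nw k : ℕ) :
    (witnessesOf (wAttempt I.basis N S O s β ℓ) Nw k).map (fun o j => (o j).map (toWLat I)) = witnessesD I.basis N S hI O s β ℓ Nw k := by
  rw [← witnessesOf_map, map_wAttempt_toWLat_eq I N S hI hS O hs β ℓ, witnessesD]

/-! ### NO instances -/

/-- **On a NO instance of `GapCVP′` the integer process accepts except with small probability.** Data: `B`
nonsingular, `n ≥ 2`, `m ≥ 1`; the NO promise `γd < λ₁(L(B))` and `γd < dist(kt, L(B))` for odd `k` (`d > 0`);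
`S ⊂ Λ = dualLat I.basis` independent with `‖sⱼ‖ ≤ σ`; a Gaussian parameter `s ≥ 2√n Dg/(γd)` (eqs. (15)–(16)) with
`n√m βσ/q < sβ` (Lemma 5.8 (iii) with the modulus condition); `1 ≤ q ≤ N`; the side condition of Thm. 5.9; oracle
success `δ′` on uniform queries above the slack `m(2ε/(1+ε) + n·dT/2^ℓ + n·q/N)` (`ε = 2⁻ⁿ`); `N_w ≥ 1` blocks of `k`
runs; `P ≥ 1` squarings with the trace slack `n(3N_w(2sβ)²d²/Dg²)^{2^P} ≤ (3N_w/100)^{2^P}`; and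
`3/80 ≤ (1 − 2ε)/(2π²)` (`n ≥ 8`). Then, with `δ_H = (1 − 2ε)/(2π²) − 3/80`,
`Pr[¬((∀ i, oᵢ ≠ none) ∧ intAcceptsZ t (num d) (den d) Dg P o)] ≤ N_w(1 − (δ′ − slack))^k + e^{−32N_wδ_H²} +
e^{−N_w/(nm)²}(4√n·nm)ⁿ + N_w·m(1+ε)/(1−ε)ε`.
[cite: MicciancioRegev2007, Thm. 5.23 (proof, NO case, pp. 29–31) — machine-decidable tests] -/
theorem toReal_toOuterMeasure_not_acc_le [IsZLattice ℝ (dualLat I.basis)] (hI : I.IsNonsingular)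
    (hS : ∀ j, intVecToEuclidean I.n (S j) ∈ dualLat I.basis) (hli : LinearIndependent ℝ fun j => intVecToEuclidean I.n (S j))
    [NeZero (MM I.basis N S)] [NeZero (Mo I.basis N)] {q : ℕ} [NeZero q] (hqN : q ≤ N)
    (O : Matrix (Fin I.n) (Fin m) (ZMod q) → PMF (Fin m → ℤ)) (hn2 : 2 ≤ I.n) (hm : 0 < m)
    {t : Fin I.n → ℤ} {d : ℚ} {γd : ℝ} (hγd : 0 < γd)
    (hmin : γd < minNorm I.lattice)
    (hodd : ∀ k : ℤ, Odd k → γd < infDist ((k : ℝ) • intVecToEuclidean I.n t) ((I.lattice : Set (EuclideanSpace ℝ (Fin I.n)))))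
    {s β σ : ℝ} (hβ : 0 < β) (hsge : 2 * Real.sqrt I.n * ((Dg I.basis : ℤ) : ℝ) / γd ≤ s)
    (hσ : ∀ j, ‖intVecToEuclidean I.n (S j)‖ ≤ σ) (hxq : I.n * Real.sqrt m * β * σ / q < s * β)
    (hnum : 1 / (2 * π) + (2⁻¹ : ℝ) ^ I.n / (1 - (2⁻¹ : ℝ) ^ I.n) + ((2⁻¹ : ℝ) ^ I.n / (1 - (2⁻¹ : ℝ) ^ I.n)) ^ 2 * m ≤ 1)
    (ℓ : ℕ)
    (hδ : m * (2 * (2⁻¹ : ℝ) ^ I.n / (1 + (2⁻¹ : ℝ) ^ I.n) + I.n * (((dT I.basis S).toNat : ℝ) / 2 ^ ℓ) + I.n * ((q : ℝ) / N)) <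
      (((PMF.uniformOfFintype (Matrix (Fin I.n) (Fin m) (ZMod q))).bind fun A =>
          (O A).map (Prod.mk A)).toOuterMeasure {az | IsSolution' az.1 β az.2}).toReal)
    (Nw k : ℕ) [NeZero Nw] {P : ℕ} (hP : 1 ≤ P)
    (hslack : (I.n : ℝ) * (Nw * (3 * (2 * s * β) ^ 2) / ((Dg I.basis : ℤ) : ℝ) ^ 2 * (d : ℝ) ^ 2) ^ (2 ^ P) ≤ (3 * Nw / 100) ^ (2 ^ P))
    (hθ : (3 / 80 : ℝ) ≤ (1 - 2 * (2⁻¹ : ℝ) ^ I.n) / (2 * π ^ 2)) :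
    ((witnessesOf (wAttempt I.basis N S O s β ℓ) Nw k).toOuterMeasure
        {o | ¬ ((∀ i, o i ≠ none) ∧ intAcceptsZ t d.num d.den (Dg I.basis).toNat P fun j => (o j).getD 0)}).toReal ≤
      Nw * (1 - ((((PMF.uniformOfFintype (Matrix (Fin I.n) (Fin m) (ZMod q))).bind fun A =>
          (O A).map (Prod.mk A)).toOuterMeasure {az | IsSolution' az.1 β az.2}).toReal -
            m * (2 * (2⁻¹ : ℝ) ^ I.n / (1 + (2⁻¹ : ℝ) ^ I.n) + I.n * (((dT I.basis S).toNat : ℝ) / 2 ^ ℓ) + I.n * ((q : ℝ) / N)))) ^ k +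
        (Real.exp (-(32 * Nw * ((1 - 2 * (2⁻¹ : ℝ) ^ I.n) / (2 * π ^ 2) - 3 / 80) ^ 2)) +
          (Real.exp (-(Nw / Real.sqrt (I.n * m) ^ 4)) * (4 * Real.sqrt I.n * Real.sqrt (I.n * m) ^ 2) ^ I.n +
            Nw * (m * ((1 + (2⁻¹ : ℝ) ^ I.n) / (1 - (2⁻¹ : ℝ) ^ I.n) * (2⁻¹ : ℝ) ^ I.n)))) := by
  haveI : IsZLattice ℝ I.lattice := LatticeInstance.isZLattice_of_isNonsingular hI
  have hn1 : 1 ≤ I.n := by omega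
  have hDp : (0 : ℝ) < ((Dg I.basis : ℤ) : ℝ) := by exact_mod_cast Dg_pos hI
  -- the scaled data: `g = γd/Dg`, `t′ = t/Dg`, `L₀ = Λ*`
  set g : ℝ := γd / ((Dg I.basis : ℤ) : ℝ) with hgdef
  set t' : EuclideanSpace ℝ (Fin I.n) := ((Dg I.basis : ℤ) : ℝ)⁻¹ • intVecToEuclidean I.n t with ht'
  have hg : 0 < g := by rw [hgdef]; positivity
  obtain ⟨hgL, hodd'⟩ := no_promise_scaled hI (intVecToEuclidean I.n t) hmin hodd
  have hsle : 2 * Real.sqrt I.n / g ≤ s := by rw [hgdef, two_sqrt_div_scaled hI hγd.ne']; exact hsge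
  have hηs2 : 2 * smoothingParameter (dualLat I.basis) ((2⁻¹ : ℝ) ^ I.n) ≤ s := two_mul_smoothingParameter_dualLat_le hI hn1 hγd hmin hsge
  have hs : 0 < s := lt_of_lt_of_le (by positivity) hsle
  -- thresholds
  set Θ' : ℝ := Nw * (3 * (2 * s * β) ^ 2) with hΘ'
  have hΘ'0 : 0 ≤ Θ' := by rw [hΘ']; positivity
  have hδH : 0 ≤ (1 - 2 * (2⁻¹ : ℝ) ^ I.n) / (2 * π ^ 2) - 3 / 80 := by linarith
  have hθb : (3 / 80 : ℝ) ≤ (1 - 2 * (2⁻¹ : ℝ) ^ I.n) / (2 * π ^ 2) - ((1 - 2 * (2⁻¹ : ℝ) ^ I.n) / (2 * π ^ 2) - 3 / 80) := by linarith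
  -- the analysed event on `witnessesD`
  have hmain := toReal_witnessesD_not_acceptsZ_le I.basis N S hI hS hli hqN O hn2 hm t' hβ hg hgL
    (fun k hk => by rw [ht']; exact hodd' k hk) hsle hηs2 hσ hxq hnum ℓ hδ Nw k hδH hθb (le_refl Θ')
  -- the pull-back of the event along the reading `o ↦ (oⱼ.map toWLat)ⱼ`
  set Wit := witnessesOf (wAttempt I.basis N S O s β ℓ) Nw k with hWit
  set G : (Fin Nw → Option (Fin I.n → ℤ)) → (Fin Nw → Option (WLat I.basis)) := fun o j => (o j).map (toWLat I) with hG
  have hsub : {o | ¬ ((∀ i, o i ≠ none) ∧ intAcceptsZ t d.num d.den (Dg I.basis).toNat P fun j => (o j).getD 0)} ∩ Wit.support ⊆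
      G ⁻¹' {o' | ¬ acceptsZ (dualLattice (dualLat I.basis)) t' (3 / 80) Θ' o'} := by
    rintro o ⟨hno, ho⟩
    simp only [Set.mem_preimage, Set.mem_setOf_eq]
    intro hacc'
    apply hno
    -- all blocks succeeded
    have hsome : ∀ i, o i ≠ none := fun i h0 => by
      have := hacc'.1 i
      rw [hG] at this
      simp only [h0, Option.map_none, ne_eq, not_true_eq_false] at this
    refine ⟨hsome, ?_⟩
    -- the witnesses `uⱼ ∈ Λ` and `G o = someW u`
    have hu : ∀ j, intVecToEuclidean I.n ((o j).getD 0) ∈ dualLat I.basis := fun j => by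
      obtain ⟨u, hu⟩ := Option.ne_none_iff_exists'.1 (hsome j)
      rw [hu, Option.getD_some]
      exact mem_dualLat_of_mem_support hS ho hu
    have hGo : G o = someW (fun j => (o j).getD 0) hu := by
      funext j
      obtain ⟨u, huj⟩ := Option.ne_none_iff_exists'.1 (hsome j)
      simp only [hG, someW, huj, Option.map_some, Option.getD_some]
      rw [toWLat_of_mem (mem_dualLat_of_mem_support hS ho huj)]
    rw [hGo] at hacc'
    refine intAcceptsZ_of_acceptsZ hI hu hP (le_refl _) hΘ'0 ?_ hacc'
    rw [hΘ']; exact hslack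
  calc (Wit.toOuterMeasure {o | ¬ ((∀ i, o i ≠ none) ∧ intAcceptsZ t d.num d.den (Dg I.basis).toNat P fun j => (o j).getD 0)}).toReal
      ≤ (Wit.toOuterMeasure (G ⁻¹' {o' | ¬ acceptsZ (dualLattice (dualLat I.basis)) t' (3 / 80) Θ' o'})).toReal :=
        ENNReal.toReal_mono (PMF.toOuterMeasure_ne_top _ _) (Wit.toOuterMeasure_mono hsub)
    _ = ((Wit.map G).toOuterMeasure {o' | ¬ acceptsZ (dualLattice (dualLat I.basis)) t' (3 / 80) Θ' o'}).toReal := by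
        rw [PMF.toOuterMeasure_map_apply]
    _ = ((witnessesD I.basis N S hI O s β ℓ Nw k).toOuterMeasure {o' | ¬ acceptsZ (dualLattice (dualLat I.basis)) t' (3 / 80) Θ' o'}).toReal := by
        rw [hWit, hG, map_witnessesOf_wAttempt_eq I N S hI hS O hs β ℓ Nw k]
    _ ≤ _ := hmain

/-! ### The machine's sampler -/

omit [NeZero N] in
/-- **Replacing the exact sampler `D_{ℤ,Ns,0}` by the machine's `D′` changes every probability of the blocks by at
most `N_w k m n Δ(D′, D_{ℤ,Ns,0})`.** [cite: Goldreich2001, §3.2 (hybrid argument and data processing)] -/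
theorem abs_toOuterMeasure_witnessesOf_sub_le {q : ℕ} (D' : PMF ℤ) (O : Matrix (Fin I.n) (Fin m) (ZMod q) → PMF (Fin m → ℤ))
    (s β : ℝ) (ℓ Nw k : ℕ) (E : Set (Fin Nw → Option (Fin I.n → ℤ))) :
    |((witnessesOf (wAttemptWith I.basis N S D' O β ℓ) Nw k).toOuterMeasure E).toReal -
        ((witnessesOf (wAttempt I.basis N S O s β ℓ) Nw k).toOuterMeasure E).toReal| ≤
      Nw * (k * (m * (I.n * D'.tvDist (discreteGaussianInt ((N : ℝ) * s) 0)))) :=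
  (PMF.abs_toReal_toOuterMeasure_sub_le_tvDist _ _ E).trans
    ((tvDist_witnessesOf_le _ _ Nw k).trans (by
      have h := tvDist_wAttemptWith_le (B := I.basis) (N := N) (S := S) D' (discreteGaussianInt ((N : ℝ) * s) 0) O β ℓ
      rw [← wAttempt] at h
      gcongr))

end DualGrid

end Literature.Algebra.EuclideanLattices

end
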